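import Mathlib
import HarnessLib
import Summits.NavierStokesRegularity.NavierStokesRegularity.Theorems.PoloidalWindowDoorPoloidalWindowRigidityLrcJetKernel

/-!
# Line `lrc-jet` of crux K2 `PoloidalWindowRigidity` — kernel replay of the exact jet certificate, part 2: single-pass checker

Cell ns-regularity-ideate, seat ns-poloidal-K2-cert-1, 2026-08-27. Bears on LADDER-NS N0 (route `PoloidalWindowDoor`, crux
stmt-NavierStokesRegularity-19708, line lrc-jet, stub `stub_lrcSpatial`). Continuation of `…LrcJetKernel` (same conventions, §1 there):
a checker whose kernel evaluation is a single pass over the generated rows — each (small) row is insertion-sorted, the sorted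
rows are merged pairwise in a balanced tree adding equal indices, and the base jet is split by component and sorted by degree so
that the row generator `rowGen2` only visits terms that can contribute.  MEASURED on the farm: an exact identity with 457
weighted Jacobian rows / ≈ 12 000 entries of the steady order-12 scheme closes by `decide +kernel` in ≈ 125 s (the global merge
sort of part 1 does not close it in 7.5 min).  Soundness as in part 1: `dot_eq_zero_of_certCheck2(_mkY)`.
`rowGen2` agrees with `rowGen` whenever `V3` lists, per component and in ascending degree, the terms of `V` (cross-checked on the
seat engine's rows by `decide +kernel`; not stated as a Lean theorem — the data files use `rowGen2` throughout).

WHAT THIS IS NOT: not a statement about Navier–Stokes regularity; pure list/linear-algebra bookkeeping for the certificates.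
-/

set_option linter.dupNamespace false
set_option autoImplicit false

namespace Summit.NavierStokesRegularity.NavierStokesRegularity.Theorems.PoloidalWindowDoorPoloidalWindowRigidityLrcJetKernel2

open Summit.NavierStokesRegularity.NavierStokesRegularity.Theorems.PoloidalWindowDoorPoloidalWindowRigidityLrcJetKernel

/-! ### §4 single-pass checker (v2): per-row insertion sort + balanced merge tree, base jet grouped by component

Kernel evaluation is call-by-need only up to its cache; v1's global merge sort re-forces the lazily generated row combination.
v2 sorts each (small) generated row by insertion, then merges the sorted rows pairwise in a balanced tree (each entry passes
through ≈ log₂(#rows) merges), adding equal indices on the fly; the base jet is split by component and sorted by degree so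
that the row generator visits only the terms that can contribute. Same soundness statement. -/

/-- insert one entry into an index-sorted sparse vector, adding coefficients on equal index. -/
def insAdd (e : ℕ × ℚ) : SpVec → SpVec
  | [] => [e]
  | f :: l => if e.1 < f.1 then e :: f :: l else if e.1 = f.1 then (f.1, e.2 + f.2) :: l else f :: insAdd e l

/-- `insAdd` adds the entry's contribution to `dot`. -/
theorem dot_insAdd (e : ℕ × ℚ) (δ : ℕ → ℚ) : ∀ l : SpVec, dot (insAdd e l) δ = e.2 * δ e.1 + dot l δ
  | [] => by simp [insAdd, dot]
  | f :: l => by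
    unfold insAdd
    split
    · rw [dot_cons]
    · split
      · rename_i _ h
        rw [dot_cons, dot_cons, h]; ring
      · rw [dot_cons, dot_cons, dot_insAdd e δ l]; ring

/-- insertion sort (with combination of equal indices) of a small sparse vector. -/
def isortAdd (l : SpVec) : SpVec := l.foldr insAdd []

/-- `isortAdd` preserves `dot`. -/
theorem dot_isortAdd (δ : ℕ → ℚ) : ∀ l : SpVec, dot (isortAdd l) δ = dot l δ
  | [] => rfl
  | e :: l => by
    show dot (insAdd e (isortAdd l)) δ = _
    rw [dot_insAdd, dot_isortAdd δ l, dot_cons]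

/-- fuelled merge of two index-sorted sparse vectors, adding coefficients on equal index. -/
def mergeAddF : ℕ → SpVec → SpVec → SpVec
  | 0, a, b => a ++ b
  | _ + 1, [], b => b
  | _ + 1, a, [] => a
  | f + 1, x :: a, y :: b =>
    if x.1 < y.1 then x :: mergeAddF f a (y :: b)
    else if y.1 < x.1 then y :: mergeAddF f (x :: a) b
    else (x.1, x.2 + y.2) :: mergeAddF f a b

/-- `mergeAddF` is additive for `dot` (for every fuel). -/
theorem dot_mergeAddF (δ : ℕ → ℚ) : ∀ (f : ℕ) (a b : SpVec), dot (mergeAddF f a b) δ = dot a δ + dot b δ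
  | 0, a, b => by simp [mergeAddF, dot_append]
  | f + 1, [], b => by simp [mergeAddF, dot]
  | f + 1, x :: a, [] => by simp [mergeAddF, dot]
  | f + 1, x :: a, y :: b => by
    unfold mergeAddF
    split
    · rw [dot_cons, dot_mergeAddF δ f a (y :: b)]; simp only [dot_cons]; ring
    · split
      · rw [dot_cons, dot_mergeAddF δ f (x :: a) b]; simp only [dot_cons]; ring
      · rename_i h1 h2
        have hxy : x.1 = y.1 := by omega
        rw [dot_cons, dot_mergeAddF δ f a b]; simp only [dot_cons]; rw [hxy]; ring

/-- sum of the `dot`s of a list of sparse vectors. -/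
def sumDot (L : List SpVec) (δ : ℕ → ℚ) : ℚ := (L.map fun v => dot v δ).sum

/-- one pass of pairwise merging. -/
def mergePass (f : ℕ) : List SpVec → List SpVec
  | a :: b :: rest => mergeAddF f a b :: mergePass f rest
  | [a] => [a]
  | [] => []

/-- `mergePass` preserves the total `dot`. -/
theorem sumDot_mergePass (f : ℕ) (δ : ℕ → ℚ) : ∀ L : List SpVec, sumDot (mergePass f L) δ = sumDot L δ
  | a :: b :: rest => by
    unfold mergePass
    simp only [sumDot, List.map_cons, List.sum_cons] at *
    have ih := sumDot_mergePass f δ rest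
    simp only [sumDot] at ih
    rw [dot_mergeAddF, ih]; ring
  | [a] => rfl
  | [] => rfl

/-- balanced merge of a list of sorted sparse vectors (outer fuel = number of passes). -/
def mergeAll : ℕ → ℕ → List SpVec → SpVec
  | 0, _, L => L.foldr (fun v acc => v ++ acc) []
  | k + 1, f, L =>
    match L with
    | [] => []
    | [a] => a
    | a :: b :: rest => mergeAll k f (mergePass f (a :: b :: rest))

/-- the fallback concatenation has the total `dot`. -/
theorem dot_foldr_append (δ : ℕ → ℚ) : ∀ L : List SpVec, dot (L.foldr (fun v acc => v ++ acc) []) δ = sumDot L δ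
  | [] => rfl
  | v :: L => by
    simp only [List.foldr_cons, sumDot, List.map_cons, List.sum_cons]
    rw [dot_append, dot_foldr_append δ L]; rfl

/-- `mergeAll` has the total `dot` of its inputs (for every fuel). -/
theorem dot_mergeAll (δ : ℕ → ℚ) : ∀ (k f : ℕ) (L : List SpVec), dot (mergeAll k f L) δ = sumDot L δ
  | 0, f, L => by unfold mergeAll; exact dot_foldr_append δ L
  | k + 1, f, [] => rfl
  | k + 1, f, [a] => by simp [mergeAll, sumDot]
  | k + 1, f, a :: b :: rest => by
    unfold mergeAll
    rw [dot_mergeAll δ k f, sumDot_mergePass]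

/-- base jet split by component, each list sorted by degree (ascending): `V3 = [terms of V₀, of V₁, of V₂]`. -/
abbrev JetTerms3 : Type := List JetTerms

/-- **Row generator, v2** (same rows as `rowGen` when `V3` lists, per component, the terms of `V` in ascending degree):
visits only base-jet terms of degree `≤ n−3` (transport part) and, for the stretching part, only the terms of the row's own
component of degree `≤ n−1`. -/
def rowGen2 (V3 : JetTerms3) (r : RowD) : SpVec :=
  let n := r.1; let kind := r.2.1; let i := r.2.2.1; let pos := r.2.2.2
  if kind = 0 then
    let m := monoAt (n - 2) pos
    let lap := (List.range 3).map fun k =>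
      (colV i n (madd m k 2), -((((mget m k + 2) * (mget m k + 1) : ℕ) : ℤ) : ℚ))
    let pres := [(colP (n - 1) (madd m i 1), (((mget m i + 1 : ℕ) : ℤ) : ℚ))]
    let bilA := V3.flatMap fun Vj => (Vj.takeWhile fun t => decide (deg t.2.1 + 3 ≤ n)).filterMap fun t =>
      let j := t.1; let m' := t.2.1; let c := t.2.2
      if mle m' m then
        some (colV i (n - 1 - deg m') (madd (msub m m') j 1), c * (((mget m j - mget m' j + 1 : ℕ) : ℤ) : ℚ))
      else none
    let bilB := ((V3.getD i []).takeWhile fun t => decide (deg t.2.1 + 1 ≤ n)).flatMap fun t =>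
      (List.range 3).filterMap fun j =>
        let μ := t.2.1; let c := t.2.2
        if decide (1 ≤ mget μ j) then
          let μ' := msub μ (madd (0, 0, 0) j 1)
          if mle μ' m then
            let m' := msub (madd m j 1) μ
            if decide (2 ≤ deg m') then some (colV j (deg m') m', (((mget μ j : ℕ) : ℤ) : ℚ) * c) else none
          else none
        else none
    lap ++ pres ++ bilA ++ bilB
  else if kind = 1 then
    let m := monoAt (n - 1) pos
    (List.range 3).map fun k => (colV k n (madd m k 1), (((mget m k + 1 : ℕ) : ℤ) : ℚ))
  else
    let m := monoAt (n - 1) pos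
    [(colV 1 n (madd m 0 1), (((mget m 0 + 1 : ℕ) : ℤ) : ℚ)), (colV 0 n (madd m 1 1), -(((mget m 1 + 1 : ℕ) : ℤ) : ℚ))]

/-- the sorted, scaled rows of a certificate. -/
def scaledRows (V3 : JetTerms3) (Y : List (RowD × ℚ)) : List SpVec :=
  Y.map fun e => isortAdd (scale e.2 (rowGen2 V3 e.1))

/-- total `dot` of the scaled rows. -/
theorem sumDot_scaledRows (V3 : JetTerms3) (δ : ℕ → ℚ) :
    ∀ Y : List (RowD × ℚ), sumDot (scaledRows V3 Y) δ = (Y.map fun e => e.2 * dot (rowGen2 V3 e.1) δ).sum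
  | [] => rfl
  | e :: Y => by
    have ih := sumDot_scaledRows V3 δ Y
    simp only [scaledRows, sumDot, List.map_cons, List.sum_cons] at *
    rw [dot_isortAdd, dot_scale, ih]

/-- **Certificate check, v2**: `Σ_r y_r J_r = D·c` via the merge tree (outer fuel 64 passes, inner fuel `F`). -/
def certCheck2 (F : ℕ) (V3 : JetTerms3) (Y : List (RowD × ℚ)) (D : ℚ) (c : SpVec) : Bool :=
  dropZeros (mergeAll 64 F (scaledRows V3 Y)) == dropZeros (isortAdd (scale D c))

/-- **Soundness of v2.** -/
theorem dot_eq_zero_of_certCheck2 (F : ℕ) (V3 : JetTerms3) (Y : List (RowD × ℚ)) (D : ℚ) (c : SpVec)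
    (hD : D ≠ 0) (hcheck : certCheck2 F V3 Y D c = true) (δ : ℕ → ℚ)
    (hJ : ∀ e ∈ Y, dot (rowGen2 V3 e.1) δ = 0) : dot c δ = 0 := by
  have h : dropZeros (mergeAll 64 F (scaledRows V3 Y)) = dropZeros (isortAdd (scale D c)) := by
    simpa [certCheck2] using hcheck
  have h1 : dot (mergeAll 64 F (scaledRows V3 Y)) δ = D * dot c δ := by
    rw [← dot_dropZeros, h, dot_dropZeros, dot_isortAdd, dot_scale]
  have h2 : dot (mergeAll 64 F (scaledRows V3 Y)) δ = 0 := by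
    rw [dot_mergeAll, sumDot_scaledRows]
    apply List.sum_eq_zero
    intro x hx
    rw [List.mem_map] at hx
    obtain ⟨e, he, rfl⟩ := hx
    rw [hJ e he, mul_zero]
  have : D * dot c δ = 0 := by rw [← h1, h2]
  rcases mul_eq_zero.mp this with h | h
  · exact absurd h hD
  · exact h

/-- v2 with rows given by indices (cf. `dot_eq_zero_of_certCheck_mkY`). -/
theorem dot_eq_zero_of_certCheck2_mkY (F N : ℕ) (V3 : JetTerms3) (rows : List ℕ) (w : List ℤ) (D : ℚ) (c : SpVec)
    (B : ℕ) (hB : rows.all (fun r => decide (r < B)) = true) (hD : D ≠ 0)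
    (hcheck : certCheck2 F V3 (mkY N rows w) D c = true) (δ : ℕ → ℚ)
    (hJ : ∀ r, r < B → dot (rowGen2 V3 (rowOfIndex N r)) δ = 0) : dot c δ = 0 := by
  refine dot_eq_zero_of_certCheck2 F V3 (mkY N rows w) D c hD hcheck δ ?_
  intro e he
  unfold mkY at he
  rw [List.mem_map] at he
  obtain ⟨p, hp, rfl⟩ := he
  have hmem : p.1 ∈ rows := (List.of_mem_zip hp).1
  have hlt : p.1 < B := of_decide_eq_true (List.all_eq_true.mp hB _ hmem)
  exact hJ _ hlt

/-- base jet grouped by component from parallel lists (entries must be listed component-major, degree-ascending). -/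
def mkV3 (js : List ℕ) (ex : List (ℕ × ℕ × ℕ)) (num : List ℤ) (den : List ℤ) : JetTerms3 :=
  let all := mkV js ex num den
  (List.range 3).map fun i => all.filter fun t => t.1 = i


end Summit.NavierStokesRegularity.NavierStokesRegularity.Theorems.PoloidalWindowDoorPoloidalWindowRigidityLrcJetKernel2
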